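import Summits.AtomisticToContinuum.HydrodynamicLimit.Theorems.AntiMazurCoboundariesKineticWindowGronwallBoostRegular
import HarnessLib

/-!
# Galilean covariance of Alexander's collision-by-collision construction on the torus

Crux `Summit.AtomisticToContinuum.HydrodynamicLimit.Theses.LambertianContactSwap.ContactAngleEquidistribution`
(stmt-AtomisticToContinuum-12097), line `Sketch` v7, stub group `boostAlexander` (registered stubs
`freeExitTime_boostAt`, `incomingPairs_boostAt`, `collisionStep_boostAt`, `stateAfter_boostAt`,
`collisionInstant_boostAt`, `collisionCount_boostAt`). Line v7 extends the proved equilibrium case of the crux from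
the rest-frame Gibbs law to drifting Gibbs laws by Galilean covariance; this file supplies the deterministic half:
under the boost `boostAt u s z = (x_i + proj (s • u), v_i + u)_i` of `…KineticWindowGronwallBoostTrajectory`
Alexander's construction (`HardSphereFlowConstruction`) is COVARIANT — the free exit time, the ordered incoming
contact pairs, the collision instants and the collision counts are invariant, one collision step of the boosted
datum is the boost (at the time advanced by the free exit time) of the step of the datum, and the `k`-th
post-collisional state of the boosted datum is the boost, at the time advanced by the REAL sum of the first `k` free
exit times, of the `k`-th state of the datum. Proof shape: the position-translation analogues
`freeExitTime_posShift`, …, `stateAfter_posShift` of `…KineticWindowGronwallBoostRegular` (free flight is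
boost-covariant, `freeFlight_boostAt`; domain / contact sets / incoming pairs are boost-invariant; the elastic
reflection commutes with the boost, `collidePair_boostAt`). References: folklore (Galilean invariance of hard-sphere
dynamics; CIP 1994 §4.2, GST 2013 §1.1).
-/

noncomputable section

open MeasureTheory Set Filter Function
open scoped ENNReal
open Literature.Analysis Literature.Analysis.FluidPDE Literature.MathematicalPhysics.KineticTheory
open Summit.AtomisticToContinuum.HydrodynamicLimit.Theorems.KineticWindowGronwallBoost

namespace Summit.AtomisticToContinuum.HydrodynamicLimit.Theorems.ContactAngleEquidistributionSketch

variable {d : Type*} [Fintype d] {n : ℕ}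

/-- **The free exit time is boost-invariant**: free flight is boost-covariant (`freeFlight_boostAt`) and the
hard-sphere domain is boost-invariant, so the set of finite times at which the free flight has left the domain is
unchanged. [folklore] -/
theorem freeExitTime_boostAt (ε : ℝ) (u : EuclideanSpace ℝ d) (s : ℝ) (z : Config n d (UnitAddTorus d)) :
    Alexander.freeExitTime (Torus.geometry d) ε (boostAt u s z) = Alexander.freeExitTime (Torus.geometry d) ε z := by
  unfold Alexander.freeExitTime
  congr 1
  ext t
  simp only [mem_setOf_eq, freeFlight_boostAt, boostAt_mem_hardSphereDomain_iff]

/-- **The ordered incoming contact pairs are boost-invariant** (contact only sees separation vectors, incoming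
only relative velocities). [folklore] -/
theorem incomingPairs_boostAt (ε : ℝ) (u : EuclideanSpace ℝ d) (s : ℝ) (z : Config n d (UnitAddTorus d)) :
    Alexander.incomingPairs (Torus.geometry d) ε (boostAt u s z) = Alexander.incomingPairs (Torus.geometry d) ε z := by
  ext p
  simp only [Alexander.mem_incomingPairs, boostAt_mem_contactSet_iff, isIncoming_boostAt_iff]

/-- **One collision step is boost-covariant**: the step of the boosted datum is the boost, at the time advanced by
the free exit time, of the step of the datum (the exit time and the exit configuration's ordered incoming pairs —
hence the selected pair — are unchanged, free flight is covariant and the reflection commutes with the boost; if the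
exit time is infinite both steps are the identity and `(∞).toReal = 0`). [folklore] -/
theorem collisionStep_boostAt (ε : ℝ) (u : EuclideanSpace ℝ d) (s : ℝ) (z : Config n d (UnitAddTorus d)) :
    Alexander.collisionStep (Torus.geometry d) ε (boostAt u s z) =
      boostAt u (s + (Alexander.freeExitTime (Torus.geometry d) ε z).toReal)
        (Alexander.collisionStep (Torus.geometry d) ε z) := by
  by_cases htop : Alexander.freeExitTime (Torus.geometry d) ε z = ∞
  · rw [Alexander.collisionStep_of_eq_top ((freeExitTime_boostAt ε u s z).trans htop),
      Alexander.collisionStep_of_eq_top htop, htop, ENNReal.toReal_top, add_zero]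
  · have htop' : Alexander.freeExitTime (Torus.geometry d) ε (boostAt u s z) ≠ ∞ := by
      rw [freeExitTime_boostAt]; exact htop
    simp only [Alexander.collisionStep, htop, htop', if_false]
    rw [freeExitTime_boostAt, freeFlight_boostAt, incomingPairs_boostAt]
    by_cases hne : (Alexander.incomingPairs (Torus.geometry d) ε
        (freeFlight (Torus.geometry d) (Alexander.freeExitTime (Torus.geometry d) ε z).toReal z)).Nonempty
    · rw [dif_pos hne, dif_pos hne, collidePair_boostAt]
    · rw [dif_neg hne, dif_neg hne]

/-- **The post-collisional states are boost-covariant**, the boost time advancing by the accumulated real exit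
times `∑_{m<k} (τ(z_m)).toReal` (induction on `k` with `collisionStep_boostAt`). [folklore] -/
theorem stateAfter_boostAt (ε : ℝ) (u : EuclideanSpace ℝ d) (s : ℝ) (z : Config n d (UnitAddTorus d)) (k : ℕ) :
    Alexander.stateAfter (Torus.geometry d) ε (boostAt u s z) k =
      boostAt u (s + ∑ m ∈ Finset.range k,
          (Alexander.freeExitTime (Torus.geometry d) ε (Alexander.stateAfter (Torus.geometry d) ε z m)).toReal)
        (Alexander.stateAfter (Torus.geometry d) ε z k) := by
  induction k with
  | zero => rw [Alexander.stateAfter_zero, Alexander.stateAfter_zero, Finset.sum_range_zero, add_zero]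
  | succ k ih =>
    rw [Alexander.stateAfter_succ, Alexander.stateAfter_succ, ih, collisionStep_boostAt, Finset.sum_range_succ,
      add_assoc]

/-- **The collision instants are boost-invariant** (each summand `τ(z_m)` is, by `stateAfter_boostAt` and
`freeExitTime_boostAt`). [folklore] -/
theorem collisionInstant_boostAt (ε : ℝ) (u : EuclideanSpace ℝ d) (s : ℝ) (z : Config n d (UnitAddTorus d)) (k : ℕ) :
    Alexander.collisionInstant (Torus.geometry d) ε (boostAt u s z) k =
      Alexander.collisionInstant (Torus.geometry d) ε z k := by
  unfold Alexander.collisionInstant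
  refine Finset.sum_congr rfl fun m _ => ?_
  rw [stateAfter_boostAt, freeExitTime_boostAt]

/-- **The collision count of every closed window `[0, t]` is boost-invariant** (it is read off the collision
instants). [folklore] -/
theorem collisionCount_boostAt (ε : ℝ) (u : EuclideanSpace ℝ d) (s : ℝ) (z : Config n d (UnitAddTorus d)) (t : ℝ) :
    Alexander.collisionCount (Torus.geometry d) ε (boostAt u s z) t =
      Alexander.collisionCount (Torus.geometry d) ε z t := by
  unfold Alexander.collisionCount
  simp only [collisionInstant_boostAt]

end Summit.AtomisticToContinuum.HydrodynamicLimit.Theorems.ContactAngleEquidistributionSketch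

end
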